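import Summits.Ventures.HodgeKum4.Theorems.KummerFixedLocusKummerPointAssembly
import Literature.AlgebraicGeometry.Hyperkaehler.GeneralizedKummerTypeFixedFourfoldTransport
import Literature.AlgebraicGeometry.Hyperkaehler.GeneralizedKummerFourTranslationFixedPoints
import HarnessLib

/-!
# The point count at the Kummer varieties closes L3° and H3 modulo print and L1 — BY NAME
(cell `hodge-kum4`, seat p2; booking B″, director-hodge 2026-08-26T06:35:07Z)

HONEST FRAMING.  Nothing here proves the point count, I1geo, L3° or the Hodge conjecture.  This
file re-keys the landed kernel chain (`KummerFixedLocusKummerPointTransport`,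
`KummerFixedLocusKummerPointAssembly`) to the NAMED statements of the tree:
* the residual `Kum4FixedPointCountAtKummer` (`@[conjecture]`, module `KummerFixedLocusDefs`:
  "exactly one of the `125` fixed points of `g ∈ Γ(K⁴(A)) ∖ 1` lies on the Kummer fixed fourfold");
* the intermediate `Kum4FixedFourfoldMeetsTranslatesAtKummer` (`@[conjecture]`, I1geo at `K⁴(A)`);
* the PRINTED inputs, all REFEREED named facts taken as hypotheses (every theorem is CONDITIONAL on
  them): the cohomological transport
  `Hyperkaehler.HassettTschinkel2013_Floccari2026_fixedFourfoldClass_transport_kum4Type` ((T):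
  Hassett–Tschinkel 2013 Thm. 2.1 + Floccari 2026 Prop. 4.6 / Lem. 4.2 + KMO 2022 Cor. 4.4), the
  split fixed points `Hyperkaehler.Oguiso2020_fixedPointScheme_translation_generalizedKummerFour`
  (Oguiso 2020 Prop. 3.6), and the eleven facts of `hc_kum4Type_of_L1_of_meetsTranslates`.
RESULT: `hc_kum4Type_of_L1_of_pointCount` — `HC_Kum4Type ∧ HC_Kum4TypePowers` from thirteen printed
statements, p1's L1 (`LefschetzGenerationKum4`) and the point count.
-/

noncomputable section

open CategoryTheory MonoidalCategory
open Literature.AlgebraicTopology.SingularHomology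
open Literature.AlgebraicGeometry Literature.AlgebraicGeometry.HodgeTheory
open Literature.AlgebraicGeometry.Hyperkaehler (IsOfGeneralizedKummerType IsGeneralizedKummerVarietyOf
  translationRep Floccari2026_fixedFourfold_kum4Type Floccari2026_card_autFixingH2H3_kum4Type
  Foster2024_translationAction_kum4Type GreenKimLazaRobles2022_llvTrivial_isOfHodgeType_kumType
  GoettscheSoergel1993_chiY_kum4Type autFixingH2H3 IsKummerFixedDatum
  HassettTschinkel2013_Floccari2026_fixedFourfoldClass_transport_kum4Type
  Oguiso2020_fixedPointScheme_translation_generalizedKummerFour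
  OGradyVoisin2022_thirdJacobian_kugaSatake_kummerType Foster2024_lefschetzStandard_kummerType_prime)

namespace Summit.Ventures.HodgeKum4

/-- **The named transport fact supplies the inline transport hypothesis** of
`KummerFixedLocusKummerPointTransport` (they differ only by `middleRep = translationRep · 8`,
definitional). -/
theorem transport_of_fact (hT : HassettTschinkel2013_Floccari2026_fixedFourfoldClass_transport_kum4Type) :
    ∀ ⦃X : Motives.SchemeOver ℂ⦄ (hX : Motives.IsSmoothProjective 8 X), IsOfGeneralizedKummerType 4 X →
      ∀ (ι : Aut X) ⦃W : Motives.SchemeOver ℂ⦄ (hW : Motives.IsSmoothProjective 4 W) (i : W ⟶ X),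
        IsKummerFixedDatum X ι W i →
        ∀ (w : singularCohomology ℤ ℤ (Motives.ComplexPoints X) 8),
          capProduct (M := ℤ) (rfl : 8 + 8 = 16) w (complexOrientationInt hX).fundamentalClass =
            singularHomology.map ℤ ℤ (Motives.AlgPoints.mapContinuous (L := ℂ) i) 8
              (complexOrientationInt hW).fundamentalClass →
          ∃ (A : Motives.AbelianVariety ℂ) (K : Motives.SchemeOver ℂ)
            (hK8 : Motives.IsSmoothProjective 8 K), A.dim = 2 ∧ IsGeneralizedKummerVarietyOf 4 A K ∧
            ∃ (ι₀ : Aut K) (W₀ : Motives.SchemeOver ℂ) (hW₀ : Motives.IsSmoothProjective 4 W₀)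
              (i₀ : W₀ ⟶ K), IsKummerFixedDatum K ι₀ W₀ i₀ ∧
              ∃ (w₀ : singularCohomology ℤ ℤ (Motives.ComplexPoints K) 8),
                capProduct (M := ℤ) (rfl : 8 + 8 = 16) w₀ (complexOrientationInt hK8).fundamentalClass =
                  singularHomology.map ℤ ℤ (Motives.AlgPoints.mapContinuous (L := ℂ) i₀) 8
                    (complexOrientationInt hW₀).fundamentalClass ∧
                ∃ (θ : autFixingH2H3 K ≃* autFixingH2H3 X) (P : complexBetti K 8 ≃ₗ[ℂ] complexBetti X 8),
                  (∀ (g : autFixingH2H3 K) (c : complexBetti K 8),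
                    P (middleRep K g c) = middleRep X (θ g) (P c)) ∧
                  P (singularCohomology.ringChange (algebraMap ℤ ℂ) (Motives.ComplexPoints K) 8 w₀) =
                    singularCohomology.ringChange (algebraMap ℤ ℂ) (Motives.ComplexPoints X) 8 w :=
  hT

/-- **I1geo ⟹ I1geo at the Kummer varieties** (by name). -/
theorem kum4FixedFourfoldMeetsTranslatesAtKummer_of_meetsTranslates (h : Kum4FixedFourfoldMeetsTranslates) :
    Kum4FixedFourfoldMeetsTranslatesAtKummer :=
  kum4FixedFourfoldMeetsTranslates_atKummerPoints_of h

/-- **The point count ⟹ I1geo at the Kummer varieties** (by name), given the printed split shape of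
the fixed points (Oguiso) and `|Γ| = 625` (Floccari). -/
theorem kum4FixedFourfoldMeetsTranslatesAtKummer_of_pointCount
    (hcard : Floccari2026_card_autFixingH2H3_kum4Type)
    (hOg : Oguiso2020_fixedPointScheme_translation_generalizedKummerFour)
    (hc : Kum4FixedPointCountAtKummer) : Kum4FixedFourfoldMeetsTranslatesAtKummer :=
  kum4FixedFourfoldMeetsTranslates_atKummerPoints_of_split_of_count hcard hOg hc

/-- **L3° from the point count** (booking B″ glue shape, by name): nine REFEREED facts + the printed
transport (T) + Oguiso's split fixed points + André's guarded fact + L1 + the point count ⟹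
`Kum4NonInvariantClassesAlgebraic`.  (The route node F_Γ, a binder of the split glue, is implied by
the printed facts `Floccari2026_card…` and `Foster2024_translationAction…` and is not needed.) -/
theorem kum4NonInvariantClassesAlgebraic_of_L1_of_pointCount
    (hA1 : Hirzebruch1969_gSignature_involution_halfDimFixedLocus)
    (hA2 : Floccari2026_fixedFourfold_kum4Type)
    (hHIR : Voisin2002_hodgeIndex_hodgeRiemann_middle)
    (hGS : GoettscheSoergel1993_chiY_kum4Type)
    (hGK : GreenKimLazaRobles2022_llvTrivial_isOfHodgeType_kumType)
    (hF : Foster2024_translationAction_kum4Type)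
    (hcardF : Floccari2026_card_autFixingH2H3_kum4Type)
    (hFu : Fulton1998_cupPairing_transversalPoint)
    (hS1 : Andre1996_dualLefschetz_mem_adjoin_lefschetzInvolution)
    (hT : HassettTschinkel2013_Floccari2026_fixedFourfoldClass_transport_kum4Type)
    (hOg : Oguiso2020_fixedPointScheme_translation_generalizedKummerFour)
    (hL1 : LefschetzGenerationKum4) (hc : Kum4FixedPointCountAtKummer) :
    Summit.Ventures.HodgeKum4.Kum4NonInvariantClassesAlgebraic :=
  kum4NonInvariantClassesAlgebraic_of_L1_of_kummerPoint (transport_of_fact hT)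
    (kum4FixedFourfoldMeetsTranslatesAtKummer_of_pointCount hcardF hOg hc)
    hA1 hA2 hHIR hGS hGK hF hcardF hFu hS1 hL1

/-- **The B″ glue `(F_Γ ∧ L1) → point count → L3°`, modulo print** (eleven printed statements as
leading hypotheses; the form the re-split glue item is closed with). -/
theorem kum4NonInvariantClassesAlgebraic_glue_of_pointCount
    (hA1 : Hirzebruch1969_gSignature_involution_halfDimFixedLocus)
    (hA2 : Floccari2026_fixedFourfold_kum4Type)
    (hHIR : Voisin2002_hodgeIndex_hodgeRiemann_middle)
    (hGS : GoettscheSoergel1993_chiY_kum4Type)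
    (hGK : GreenKimLazaRobles2022_llvTrivial_isOfHodgeType_kumType)
    (hF : Foster2024_translationAction_kum4Type)
    (hcardF : Floccari2026_card_autFixingH2H3_kum4Type)
    (hFu : Fulton1998_cupPairing_transversalPoint)
    (hS1 : Andre1996_dualLefschetz_mem_adjoin_lefschetzInvolution)
    (hT : HassettTschinkel2013_Floccari2026_fixedFourfoldClass_transport_kum4Type)
    (hOg : Oguiso2020_fixedPointScheme_translation_generalizedKummerFour) :
    (Summit.Ventures.HodgeKum4.Kum4TranslationGroup ∧ Summit.Ventures.HodgeKum4.LefschetzGenerationKum4) →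
      Summit.Ventures.HodgeKum4.Kum4FixedPointCountAtKummer →
        Summit.Ventures.HodgeKum4.Kum4NonInvariantClassesAlgebraic :=
  fun ⟨_, hL1⟩ hc =>
    kum4NonInvariantClassesAlgebraic_of_L1_of_pointCount hA1 hA2 hHIR hGS hGK hF hcardF hFu hS1 hT hOg hL1 hc

/-- **H3 for `Kum⁴`-type and its powers from thirteen printed statements, L1 and the point count**
(by name): the Hodge conjecture for every smooth projective `Kum⁴`-type eightfold and all its powers,
CONDITIONAL on the eleven REFEREED facts of `hc_kum4Type_of_L1_of_meetsTranslates`, the printed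
transport (T), Oguiso's split fixed points, p1's L1, and the residual `Kum4FixedPointCountAtKummer`. -/
theorem hc_kum4Type_of_L1_of_pointCount
    (hOGV : OGradyVoisin2022_thirdJacobian_kugaSatake_kummerType)
    (hFF : FloccariFu2026_hodgeClasses_algebraic_powers_discOneWeilFourfold)
    (hFo : Foster2024_lefschetzStandard_kummerType_prime)
    (hAn : Andre1996_dualLefschetz_mem_adjoin_lefschetzInvolution)
    (hA1 : Hirzebruch1969_gSignature_involution_halfDimFixedLocus)
    (hA2 : Floccari2026_fixedFourfold_kum4Type)
    (hHIR : Voisin2002_hodgeIndex_hodgeRiemann_middle)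
    (hGS : GoettscheSoergel1993_chiY_kum4Type)
    (hGK : GreenKimLazaRobles2022_llvTrivial_isOfHodgeType_kumType)
    (hF : Foster2024_translationAction_kum4Type)
    (hcardF : Floccari2026_card_autFixingH2H3_kum4Type)
    (hFu : Fulton1998_cupPairing_transversalPoint)
    (hT : HassettTschinkel2013_Floccari2026_fixedFourfoldClass_transport_kum4Type)
    (hOg : Oguiso2020_fixedPointScheme_translation_generalizedKummerFour)
    (hL1 : LefschetzGenerationKum4) (hc : Kum4FixedPointCountAtKummer) :
    Summit.Ventures.HodgeKum4.HC_Kum4Type ∧ Summit.Ventures.HodgeKum4.HC_Kum4TypePowers :=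
  hc_kum4Type_of_L1_of_kummerPoint (transport_of_fact hT)
    (kum4FixedFourfoldMeetsTranslatesAtKummer_of_pointCount hcardF hOg hc)
    hOGV hFF hFo hAn hA1 hA2 hHIR hGS hGK hF hcardF hFu hL1

end Summit.Ventures.HodgeKum4

end
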